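import Summits.AtomisticToContinuum.HydrodynamicLimit.Theorems.MourreKoopmanChargesLinearToEntropyInBandMesoscopicStatics
import HarnessLib

/-!
# Route `MourreKoopmanCharges`, crux `LinearToEntropyInBand` (stmt-AtomisticToContinuum-17740), skeleton v8:
# the dense-count clause (ii-pos) of `MesoscopicBlockLD` — deterministic core

Support file (`--supports` the crux; worker of lead prover-line-…-17740-c6-0, wave 1, stub `stub_mesoscopicDenseCount`)
for the POSITION-ONLY clause (ii-pos) of the registered helper `stub_mesoscopicBlockLD` — the hypothesis of the landed
glue `glue_mesoscopicBlockLD_of_pos` (`…MesoscopicStatics` § 4): an exponential moment, at one rate `c₀ > 0`, of the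
NUMBER of `R`-dense particles (`(5/4) ρ₀(qᵢ) < (N+1)⁻¹ Σⱼ cone R N qᵢ qⱼ`) under the configurational canonical
hard-sphere Gibbs measure `posGibbsMeasure (ρ₀ · Rf(σ³ρ₀)) ε_N (N+1)`, of size `exp(ε (N+1))` for `R ≥ R₀(ε)`,
`N ≥ N₀`.  The clause is NOT closed here; this file is its measure-free (every configuration) half, the companion
`…MesoscopicDenseCountMoment` the abstract moment half.  Write `ν = (N+1)^{-1/3}`, `r = Rν`.

* § 1 `inv_mul_cone_eq`, `coneDensity_le_discretised`: the `R`-cone density at a centre `x` is `3/(πR³)` times the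
  cone-weighted count `Σⱼ (1 - d(x,qⱼ)/r)₊`, which is at most the Riemann sum `K⁻¹ Σ_{k<K} #{j : d(x,qⱼ) < (k+1) r/K}`
  of the radial profile of BALL COUNTS (`max_zero_one_sub_le_discretised`, telescoping).
* § 2 `coneDensity_le_of_ballBounds`: if the ball of radius `(k₀/K) r` holds `≤ A` particles and the balls of radii
  `((k+1)/K) r`, `k₀ ≤ k < K`, hold `≤ b k`, the cone density is `≤ 3/(πR³)(k₀A/K + K⁻¹ Σ b k)`; with the cubic
  budget `b k = (1+κ') ρ̄ (4π/3) R³ ((k+1)/K)³` this is `κ ρ + (1+κ') ρ̄ (1 + 1/K)²` (`sum_Ico_cube_le`), below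
  `(5/4) ρ` for `κ = κ' = 1/16`, `K ≥ 100`, `ρ̄ ≤ (1+κ) ρ` — the small radii carry the weight `k₀/K` only, so the
  self-term and the O(1) neighbours at microscopic distance are harmless (a ball-by-ball test at ALL radii would flag
  every particle with a neighbour at distance `≍ ν`).
* § 3 `dense_imp_overdense_ball`: re-centred on any point `z` with `d(z, qᵢ) ≤ δ` (a grid point; triangle inequality,
  `card_ball_le_card_ball_of_near`), a dense particle forces an OVERDENSE BALL ABOUT `z`: count `> A` at radius
  `(k₀/K) r + δ` (overdensity factor `≍ κ (K/k₀)⁴ ≫ 1`) or count `> b k` at a radius `((k+1)/K) r + δ ≥ (k₀/K) r`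
  (overdensity factor `1 + κ'`): finitely many large-deviation events of ball counts at scale `r` about FIXED centres.
* § 4 `sum_ite_le_sum_card_mul_ite`: hence `#{dense} ≤ Σ_z n_z 𝟙[E_z]` over the grid cells (`n_z` = occupation of
  the cell of `z`, `E_z` = an overdense ball about `z`).

Blueprint of the remaining (probabilistic) half — ELEMENTARY: an alternative to the Poisson-domination route named
in the header of `…MesoscopicStatics` that needs no point-process domination, FKG or cluster expansion.  With
`C = (4M₀+2)³` colours of the grid of mesh `r/M₀` (equal colours ⇒ pairwise disjoint `2r`-neighbourhoods `W_z`),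
Hölder gives `∫ exp(c₀ Σ_z Y_z) ≤ ∏_c (∫ ∏_{z ∈ c} exp(C c₀ Y_z))^{1/C}` and `∏_{z∈c} exp(θ Y_z) ≤ ∏ (1 + G_z)`,
`G_z = 𝟙_{E_z} e^{θ n_z}`, so that JOINT bounds `∫ ∏_{z ∈ A} G_z d(posGibbs) ≤ 2 ∏_{z∈A} δ_z`, `A ⊆ c`, suffice
(companion file: `lintegral_exp_sum_le_prod_colour`, `lintegral_prod_one_add_le`, `prod_rpow_le_exp_of_le`).  For the
canonical hard-core measure (`posGibbsMeasure = Ξ⁻¹ β^{⊗n}|_D`, `HardSphereEulerLLN.posGibbsMeasure_eq`) they follow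
from the labelled decomposition over which particles lie in `V = ⋃_{z∈A} W_z`,
`∫ 1_D ∏ G_z dβ^{⊗n} ≤ Σ_k (n choose k⃗) ∏_z [∫_{W_z^{k_z}} G_z dβ^{⊗k_z}] · Z_{n-|k|}(V^c)` (drop the hard core
except among the particles off `V`), the insertion bound `Z_{m-1}/Z_m ≤ (1 - λ₁)⁻¹`,
`λ₁ = n sup_y β(B_ε(y)) = O(η₀)` (`StatisticalMechanics.hcProb_insert_ge`), and the VOID bound
`Z_m(V^c)/Z_m ≤ 2 ((1-p_V)/(1-η'' p_V))^m`, `p_V = β(V)`, `η'' = 4λ₁ + o_R(1)` (the same free-volume ratio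
argument run downwards in the number of particles in `V` — the free volume of `V` seen by `j ≤ 4np_V` particles in
`V` and a hard-core collar of `O(|A| R²/σ²)` particles outside is `≥ p_V (1-η'')` — plus Markov for the comparison
binomial); together, `∫ ∏_{z∈A} G_z d(posGibbs) ≤ 2 e^{c_err n p_V} ∫ ∏_{z ∈ A} G_z dβ̂^{⊗n}` with
`c_err = λ₁/(1-λ₁) + 2η'' = O(η₀) + o_R(1)` and the probability profile `β̂ ∝ β (1-λ₁)⁻¹` on `V`, `∝ β` off `V`.
Under the product measure `β̂^{⊗n}` the Laplace transform of disjoint ball counts is dominated by the Poisson product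
(`(1 + Σ_z p_z (e^{s_z}-1))^n ≤ ∏_z exp(n p_z (e^{s_z}-1))`) and Chernoff gives
`δ_z ≤ e^{c_err n p_{W_z}} |T| exp(-Λ_B (h(u) - u θ))`, `h(u) = u log u - u + 1`, `u ≥ 1 + κ'/2`, `Λ_B ≍ ρ₀ R³`,
which tends to `0` as `R → ∞` once `η₀` is below an ABSOLUTE constant (times `(1+L)⁻¹`, `L` the Lipschitz constant
of `Rf`; `ρ₀` enters only through sup/inf ratios over `2r`-neighbourhoods, `→ 1` as `N → ∞` uniformly on the
slab, and through `R₀`, `N₀`).  Sizing: 2–3 worker sessions (decomposition + void bound; product-measure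
Chernoff + grid/colouring on `𝕋³` + assembly through `glue_mesoscopicBlockLD_of_pos`).
References: H. Spohn, *Large Scale Dynamics of Interacting Particles* (1991), Part I § 2.3; E. Pulvirenti,
D. Tsagkarogiannis, Comm. Math. Phys. 316 (2012) 289 (canonical hard-core insertion ratios).
-/

noncomputable section

open MeasureTheory Filter Set
open scoped ENNReal Topology BigOperators

namespace Summit.AtomisticToContinuum.HydrodynamicLimit.Theorems.LTEInBand

open Literature.MathematicalPhysics.KineticTheory Literature.Analysis.FluidPDE

/-! ## § 1 The `R`-cone density as a discretised radial profile of ball counts -/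

section Deterministic

variable {N : ℕ}

/-- **The normalised cone kernel.** `(N+1)⁻¹ cone R N x y = 3/(πR³) · (1 - d(x,y)/(Rν))₊` with `ν = (N+1)^{-1/3}`
(`ν³ = (N+1)⁻¹`; `0 < R`): the `R`-cone density is `3/(πR³)` times a cone-weighted particle count. -/
theorem inv_mul_cone_eq {R : ℝ} (hR : 0 < R) (N : ℕ) (x y : T3) :
    ((N : ℝ) + 1)⁻¹ * cone R N x y =
      3 / (Real.pi * R ^ 3) * max 0 (1 - Torus.euclidDist x y / (R * ((N : ℝ) + 1) ^ (-(1 / 3 : ℝ)))) := by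
  have hN : (0 : ℝ) < (N : ℝ) + 1 := by positivity
  have h3 : (((N : ℝ) + 1) ^ (-(1 / 3 : ℝ))) ^ 3 = ((N : ℝ) + 1)⁻¹ := by
    rw [← Real.rpow_natCast, ← Real.rpow_mul hN.le]
    norm_num
    exact Real.rpow_neg_one _
  unfold cone
  rw [mul_pow, h3]
  field_simp

/-- **Discretisation of the cone profile.** For `0 ≤ u` and `0 < K`,
`(1 - u)₊ ≤ K⁻¹ #{k < K : u < (k+1)/K}` (telescoping of `k ↦ (k/K - u)₊`, whose increments are at most `K⁻¹` and
vanish once `(k+1)/K ≤ u`). -/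
theorem max_zero_one_sub_le_discretised {u : ℝ} (hu : 0 ≤ u) {K : ℕ} (hK : 0 < K) :
    max 0 (1 - u) ≤ (K : ℝ)⁻¹ * ∑ k ∈ Finset.range K, (if u < ((k : ℝ) + 1) / K then (1 : ℝ) else 0) := by
  have hK' : (0 : ℝ) < K := Nat.cast_pos.2 hK
  set f : ℕ → ℝ := fun k => max 0 ((k : ℝ) / K - u) with hf
  have htel : ∑ k ∈ Finset.range K, (f (k + 1) - f k) = f K - f 0 := Finset.sum_range_sub f K
  have hfK : f K = max 0 (1 - u) := by simp [hf, div_self hK'.ne']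
  have hf0 : f 0 = 0 := by simp [hf, hu]
  have hstep : ∀ k ∈ Finset.range K,
      f (k + 1) - f k ≤ (K : ℝ)⁻¹ * (if u < ((k : ℝ) + 1) / K then (1 : ℝ) else 0) := by
    intro k _
    have hk1 : (((k + 1 : ℕ) : ℝ)) / K = (k : ℝ) / K + (K : ℝ)⁻¹ := by push_cast; field_simp
    simp only [hf, hk1]
    split_ifs with h
    · rw [mul_one]
      have hmax : max 0 ((k : ℝ) / K + (K : ℝ)⁻¹ - u) ≤ max 0 ((k : ℝ) / K - u) + (K : ℝ)⁻¹ :=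
        max_le (by positivity) (by linarith [le_max_right 0 ((k : ℝ) / K - u)])
      linarith
    · rw [mul_zero]
      have h' : (k : ℝ) / K + (K : ℝ)⁻¹ ≤ u := by
        have := not_lt.1 h
        rwa [show ((k : ℝ) + 1) / K = (k : ℝ) / K + (K : ℝ)⁻¹ by field_simp] at this
      rw [max_eq_left (by linarith : (k : ℝ) / K + (K : ℝ)⁻¹ - u ≤ 0)]
      linarith [le_max_left 0 ((k : ℝ) / K - u)]
  calc max 0 (1 - u) = f K - f 0 := by rw [hfK, hf0, sub_zero]
    _ = ∑ k ∈ Finset.range K, (f (k + 1) - f k) := htel.symm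
    _ ≤ ∑ k ∈ Finset.range K, (K : ℝ)⁻¹ * (if u < ((k : ℝ) + 1) / K then (1 : ℝ) else 0) :=
        Finset.sum_le_sum hstep
    _ = _ := by rw [Finset.mul_sum]

/-- **The cone density is dominated by the discretised radial profile of ball counts**: for `0 < R`, `0 < K` and
any centre `x`, `(N+1)⁻¹ Σⱼ cone R N x qⱼ ≤ 3/(πR³) · K⁻¹ Σ_{k<K} #{j : d(x, qⱼ) < (k+1) Rν/K}`. -/
theorem coneDensity_le_discretised {R : ℝ} (hR : 0 < R) {K : ℕ} (hK : 0 < K) (q : Fin (N + 1) → T3) (x : T3) :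
    ((N : ℝ) + 1)⁻¹ * ∑ j, cone R N x (q j) ≤ 3 / (Real.pi * R ^ 3) * ((K : ℝ)⁻¹ * ∑ k ∈ Finset.range K,
      ((Finset.univ.filter fun j => Torus.euclidDist x (q j) <
        ((k : ℝ) + 1) / K * (R * ((N : ℝ) + 1) ^ (-(1 / 3 : ℝ)))).card : ℝ)) := by
  set r : ℝ := R * ((N : ℝ) + 1) ^ (-(1 / 3 : ℝ)) with hr
  have hN : (0 : ℝ) < (N : ℝ) + 1 := by positivity
  have hr0 : 0 < r := mul_pos hR (Real.rpow_pos_of_pos hN _)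
  rw [Finset.mul_sum]
  simp_rw [inv_mul_cone_eq hR]
  rw [← Finset.mul_sum]
  refine mul_le_mul_of_nonneg_left ?_ (by positivity)
  calc ∑ j, max 0 (1 - Torus.euclidDist x (q j) / r)
      ≤ ∑ j, (K : ℝ)⁻¹ * ∑ k ∈ Finset.range K,
          (if Torus.euclidDist x (q j) / r < ((k : ℝ) + 1) / K then (1 : ℝ) else 0) :=
        Finset.sum_le_sum fun j _ => max_zero_one_sub_le_discretised (div_nonneg (norm_nonneg _) hr0.le) hK
    _ = (K : ℝ)⁻¹ * ∑ k ∈ Finset.range K, ∑ j, (if Torus.euclidDist x (q j) < ((k : ℝ) + 1) / K * r then (1 : ℝ) else 0) := by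
        rw [← Finset.mul_sum, Finset.sum_comm]
        congr 1
        refine Finset.sum_congr rfl fun k _ => Finset.sum_congr rfl fun j _ => ?_
        simp only [div_lt_iff₀ hr0]
    _ = _ := by
        congr 1
        refine Finset.sum_congr rfl fun k _ => ?_
        rw [Finset.natCast_card_filter]

/-! ## § 2 Sparse balls at all discretised radii force non-density -/

/-- **Ball counts are monotone in the radius.** -/
theorem card_ball_mono (q : Fin (N + 1) → T3) (x : T3) {ρ ρ' : ℝ} (h : ρ ≤ ρ') :
    (Finset.univ.filter fun j => Torus.euclidDist x (q j) < ρ).card ≤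
      (Finset.univ.filter fun j => Torus.euclidDist x (q j) < ρ').card :=
  Finset.card_le_card (Finset.monotone_filter_right _ fun _ _ hj => lt_of_lt_of_le hj h)

/-- **Sparse balls force non-density (the deterministic core, centred form).**  Fix `0 < R`, a discretisation
`0 < k₀ ≤ K` of the radii `(k/K)·Rν`, a level `ρ`, a small-ball budget `A` and large-ball budgets `b k`.  If the ball
of radius `(k₀/K) Rν` about `x` holds at most `A` particles, each ball of radius `((k+1)/K) Rν`, `k₀ ≤ k < K`, at most
`b k` particles, and `3/(πR³) · (k₀ A/K + K⁻¹ Σ_{k₀ ≤ k < K} b k) ≤ (5/4) ρ`, then the `R`-cone density at `x` is at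
most `(5/4) ρ`: the centre is NOT dense at level `ρ`.  (With `A = κ ρ πR³ K/(3k₀)` and `b k = (1+κ') ρ̄ (4π/3) R³
((k+1)/K)³` the budget is `κ ρ + (1+κ') ρ̄ (1 + 1/K)²`, `sum_Ico_cube_le`.) -/
theorem coneDensity_le_of_ballBounds {R : ℝ} (hR : 0 < R) {K k₀ : ℕ} (hk₀ : 0 < k₀) (hk₀K : k₀ ≤ K)
    (q : Fin (N + 1) → T3) (x : T3) {ρ A : ℝ} {b : ℕ → ℝ}
    (hA : ((Finset.univ.filter fun j => Torus.euclidDist x (q j) <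
      (k₀ : ℝ) / K * (R * ((N : ℝ) + 1) ^ (-(1 / 3 : ℝ)))).card : ℝ) ≤ A)
    (hb : ∀ k ∈ Finset.Ico k₀ K, ((Finset.univ.filter fun j => Torus.euclidDist x (q j) <
      ((k : ℝ) + 1) / K * (R * ((N : ℝ) + 1) ^ (-(1 / 3 : ℝ)))).card : ℝ) ≤ b k)
    (hthr : 3 / (Real.pi * R ^ 3) * ((k₀ : ℝ) / K * A + (K : ℝ)⁻¹ * ∑ k ∈ Finset.Ico k₀ K, b k) ≤ 5 / 4 * ρ) :
    ((N : ℝ) + 1)⁻¹ * ∑ j, cone R N x (q j) ≤ 5 / 4 * ρ := by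
  have hN : (0 : ℝ) < (N : ℝ) + 1 := by positivity
  have hK : 0 < K := hk₀.trans_le hk₀K
  have hK' : (0 : ℝ) < K := Nat.cast_pos.2 hK
  refine (coneDensity_le_discretised hR hK q x).trans ?_
  refine (mul_le_mul_of_nonneg_left ?_ (by positivity)).trans hthr
  set r : ℝ := R * ((N : ℝ) + 1) ^ (-(1 / 3 : ℝ)) with hr
  have hr0 : 0 < r := mul_pos hR (Real.rpow_pos_of_pos hN _)
  -- the radial count profile `c k = #{j : d(x, qⱼ) < (k/K) r}`
  obtain ⟨c, hc⟩ : ∃ c : ℕ → ℝ, ∀ k : ℕ,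
      c k = ((Finset.univ.filter fun j => Torus.euclidDist x (q j) < (k : ℝ) / K * r).card : ℝ) := ⟨_, fun _ => rfl⟩
  have hc1 : ∀ k : ℕ, ((Finset.univ.filter fun j => Torus.euclidDist x (q j) < ((k : ℝ) + 1) / K * r).card : ℝ) =
      c (k + 1) := fun k => by rw [hc]; push_cast; rfl
  simp_rw [hc1]
  rw [← Finset.sum_range_add_sum_Ico _ hk₀K, mul_add, div_eq_mul_inv, mul_comm (k₀ : ℝ), mul_assoc]
  refine add_le_add (mul_le_mul_of_nonneg_left ?_ (by positivity)) (mul_le_mul_of_nonneg_left ?_ (by positivity))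
  · -- small radii: each of the `k₀` counts is at most the count at radius `k₀/K`, hence at most `A`
    calc ∑ k ∈ Finset.range k₀, c (k + 1) ≤ ∑ _k ∈ Finset.range k₀, A := by
          refine Finset.sum_le_sum fun k hk => le_trans ?_ hA
          rw [hc]
          have hk' : ((k + 1 : ℕ) : ℝ) ≤ k₀ := by exact_mod_cast Nat.succ_le_of_lt (Finset.mem_range.1 hk)
          exact_mod_cast card_ball_mono q x
            (mul_le_mul_of_nonneg_right (div_le_div_of_nonneg_right hk' hK'.le) hr0.le)
      _ = (k₀ : ℝ) * A := by rw [Finset.sum_const, Finset.card_range, nsmul_eq_mul]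
  · exact Finset.sum_le_sum fun k hk => (hc1 k).symm.le.trans (hb k hk)

/-- `Σ_{k<K} (k+1)³ = (K(K+1)/2)²`. -/
theorem sum_range_succ_cube (K : ℕ) : ∑ k ∈ Finset.range K, ((k : ℝ) + 1) ^ 3 = ((K : ℝ) * ((K : ℝ) + 1) / 2) ^ 2 := by
  induction K with
  | zero => simp
  | succ K ih => rw [Finset.sum_range_succ, ih]; push_cast; ring

/-- **The cubic budget.** `K⁻¹ Σ_{k₀ ≤ k < K} ((k+1)/K)³ ≤ (1 + 1/K)²/4` (Riemann sum of `s³` on `[0,1]`). -/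
theorem sum_Ico_cube_le {K : ℕ} (hK : 0 < K) (k₀ : ℕ) :
    (K : ℝ)⁻¹ * ∑ k ∈ Finset.Ico k₀ K, (((k : ℝ) + 1) / K) ^ 3 ≤ (1 + (K : ℝ)⁻¹) ^ 2 / 4 := by
  have hK' : (0 : ℝ) < K := Nat.cast_pos.2 hK
  have hsub : ∑ k ∈ Finset.Ico k₀ K, (((k : ℝ) + 1) / K) ^ 3 ≤ ∑ k ∈ Finset.range K, (((k : ℝ) + 1) / K) ^ 3 := by
    refine Finset.sum_le_sum_of_subset_of_nonneg ?_ fun k _ _ => by positivity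
    rw [Finset.range_eq_Ico]
    exact Finset.Ico_subset_Ico_left (Nat.zero_le _)
  refine (mul_le_mul_of_nonneg_left hsub (by positivity)).trans (le_of_eq ?_)
  simp_rw [div_pow]
  rw [← Finset.sum_div, sum_range_succ_cube]
  field_simp
  ring

/-! ## § 3 Re-centring on a nearby grid point, and the dense ⇒ overdense-ball alternative -/

/-- **Re-centring.** If `d(z, x) ≤ δ` then every ball count about `x` is at most the count about `z` at the radius
enlarged by `δ` (triangle inequality of the minimal-image distance). -/
theorem card_ball_le_card_ball_of_near (q : Fin (N + 1) → T3) {x z : T3} {δ : ℝ} (hz : Torus.euclidDist z x ≤ δ)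
    (ρ : ℝ) :
    (Finset.univ.filter fun j => Torus.euclidDist x (q j) < ρ).card ≤
      (Finset.univ.filter fun j => Torus.euclidDist z (q j) < ρ + δ).card :=
  Finset.card_le_card (Finset.monotone_filter_right _ fun j _ hj =>
    lt_of_le_of_lt (euclidDist_triangle z x (q j)) (by linarith))

/-- **DENSE ⇒ AN OVERDENSE BALL ABOUT THE NEARBY GRID POINT (the deterministic core).**  Let particle `i` be
`R`-dense at level `ρ` (`(5/4) ρ < (N+1)⁻¹ Σⱼ cone R N qᵢ qⱼ`), let `z` be any point with `d(z, qᵢ) ≤ δ` (a grid point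
of mesh `≍ δ`), and let the budgets satisfy `3/(πR³) (k₀ A/K + K⁻¹ Σ_{k₀ ≤ k < K} b k) ≤ (5/4) ρ`.  Then either the
small ball `B(z, (k₀/K) Rν + δ)` holds more than `A` particles, or some ball `B(z, ((k+1)/K) Rν + δ)`, `k₀ ≤ k < K`,
holds more than `b k` particles.  With `A ≍ κ ρ R³ K/k₀` (overdensity factor `≍ κ K⁴/k₀⁴ ≫ 1`) and
`b k = (1+κ') sup_{B(z,2Rν)} ρ₀ · (4π/3) R³ ((k+1)/K)³` (overdensity factor `1 + κ'` at every mesoscopic radius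
`≥ (k₀/K) Rν`), every alternative is a large-deviation event of a ball count at scale `Rν` about a FIXED centre. -/
theorem dense_imp_overdense_ball {R : ℝ} (hR : 0 < R) {K k₀ : ℕ} (hk₀ : 0 < k₀) (hk₀K : k₀ ≤ K)
    (q : Fin (N + 1) → T3) (i : Fin (N + 1)) {z : T3} {δ : ℝ} (hz : Torus.euclidDist z (q i) ≤ δ)
    {ρ A : ℝ} {b : ℕ → ℝ}
    (hthr : 3 / (Real.pi * R ^ 3) * ((k₀ : ℝ) / K * A + (K : ℝ)⁻¹ * ∑ k ∈ Finset.Ico k₀ K, b k) ≤ 5 / 4 * ρ)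
    (hdense : 5 / 4 * ρ < ((N : ℝ) + 1)⁻¹ * ∑ j, cone R N (q i) (q j)) :
    A < ((Finset.univ.filter fun j => Torus.euclidDist z (q j) <
        (k₀ : ℝ) / K * (R * ((N : ℝ) + 1) ^ (-(1 / 3 : ℝ))) + δ).card : ℝ) ∨
      ∃ k ∈ Finset.Ico k₀ K, b k < ((Finset.univ.filter fun j => Torus.euclidDist z (q j) <
        ((k : ℝ) + 1) / K * (R * ((N : ℝ) + 1) ^ (-(1 / 3 : ℝ))) + δ).card : ℝ) := by
  by_contra h
  push Not at h
  obtain ⟨hA, hb⟩ := h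
  refine absurd hdense (not_lt.2 (coneDensity_le_of_ballBounds hR hk₀ hk₀K q (q i) ?_ (fun k hk => ?_) hthr))
  · exact le_trans (by exact_mod_cast card_ball_le_card_ball_of_near q hz _) hA
  · exact le_trans (by exact_mod_cast card_ball_le_card_ball_of_near q hz _) (hb k hk)

/-! ## § 4 Counting the dense particles cell by cell -/

/-- **Cellwise count.** If every flagged index `i` (`D i`) certifies the event `E (cell i)` of its cell, then
`#{i : D i} ≤ Σ_g #{i : cell i = g} · 𝟙[E g]`: the number of dense particles is dominated by the sum over the grid
cells of (occupation of the cell) × 𝟙(an overdense ball about the cell's grid point). -/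
theorem sum_ite_le_sum_card_mul_ite {ι G : Type*} [Fintype ι] [Fintype G] [DecidableEq G] (cell : ι → G)
    (D : ι → Prop) (E : G → Prop) [DecidablePred D] [DecidablePred E] (h : ∀ i, D i → E (cell i)) :
    (∑ i, (if D i then (1 : ℝ) else 0)) ≤
      ∑ g, ((Finset.univ.filter fun i => cell i = g).card : ℝ) * (if E g then (1 : ℝ) else 0) := by
  calc (∑ i, (if D i then (1 : ℝ) else 0)) ≤ ∑ i, (if E (cell i) then (1 : ℝ) else 0) := by
        refine Finset.sum_le_sum fun i _ => ?_
        by_cases hD : D i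
        · rw [if_pos hD, if_pos (h i hD)]
        · rw [if_neg hD]; split_ifs <;> norm_num
    _ = ∑ g, ∑ i ∈ Finset.univ.filter (fun i => cell i = g), (if E (cell i) then (1 : ℝ) else 0) :=
        (Finset.sum_fiberwise Finset.univ cell _).symm
    _ = _ := by
        refine Finset.sum_congr rfl fun g _ => ?_
        rw [Finset.sum_congr rfl fun i hi => by rw [(Finset.mem_filter.1 hi).2], Finset.sum_const, nsmul_eq_mul]

end Deterministic


end Summit.AtomisticToContinuum.HydrodynamicLimit.Theorems.LTEInBand

end
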